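import Mathlib
import HarnessLib
import Literature.Analysis.FluidPDE.ParabolicComparison
import Literature.Analysis.FluidPDE.SteadyLiouvilleTsaiKit
import Summits.NavierStokesRegularity.NavierStokesRegularity.Theorems.PoloidalWindowDoorPoloidalWindowRigidityTimeHeightShearWeight

/-!
# Item `LrcModEntire` (stmt-NavierStokesRegularity-20428), skeleton twist_split v6, CLASS road to `stub_twistingTHGerm` —
# bricks B1/B2 of the plane-oscillation law (OSC): the two-point material identity at equal height and the plane-extremum conditions

Cell ns-regularity-ideate, seat ns-k2-port-2 g3 (kernel-port lineage of item 20428; bricks NAMED by the LEAD ns-poloidal-K2-p3 g12,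
STATUS 2026-08-28T23:52:36Z (3); `--supports stmt-NavierStokesRegularity-20428 --as helper`).  Setting: a profile `v` of the route's
Type-I class, poloidal, on the stratum (TH) `∂₂v_b(s,y) = μ(s,y₂)∂_b v₂(s,y)` (`b = 0,1`); the weighted Clebsch weight
`W(t,y) := (1 − μ(t,y₂))·v₂(t,y)` and its material derivative `𝓛W := ∂ₜW + v·∇W − ΔW`, for which ns-poloidal-K2-p2's
`…TimeHeightShearWeight.material_W_eq` + `horizFDeriv_weightSource_eq_zero` give `𝓛W = 𝒜(t,x₂) − (μ_z/2)v₂²` with `∇ₕ𝒜 = 0`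
(LEAD memo NORMALFORM-TH-g12 §6).

* `weightSource_eq_of_height_eq` — the doubled source `2𝒜` takes the same value at two points of the same height (the segment argument of
  `…TimeHeightShearVariance.residual_TH_eq_of_height_eq`, but division-free: no `μ < 1` needed, and (TH) is only assumed near the plane).
* `material_W_sub_of_height_eq` (**B1**) — for `y₂ = y′₂`: `𝓛W(t,y) − 𝓛W(t,y′) = −(μ_z(t,y₂)/2)·(v₂(t,y)² − v₂(t,y′)²)` — the height-only
  source cancels exactly.
* plane calculus (**B2**, generic `G : ℝ³ → ℝ`): at a local maximum of `G` RESTRICTED TO A HORIZONTAL PLANE the horizontal partials vanish, the pure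
  horizontal second partials are `≤ 0`, `DG(x)u = u₂∂₂G(x)` and `ΔG ≤ ∂₂∂₂G` (+ minimum versions); `planeExtremum_conditions` = B2 for `G = W(t,·)`.
* `osc_twoPoint` — **B1 + B2**: if `x⁺` is a plane maximum and `x⁻` a plane minimum of `W(t,·)` on the SAME plane, then
  `[∂ₜW + v₂∂₂W − ∂₂∂₂W](x⁺) − [∂ₜW + v₂∂₂W − ∂₂∂₂W](x⁻) ≤ −(μ_z/2)(v₂(x⁺)² − v₂(x⁻)²)` — the pointwise core of (OSC) before the
  envelope step (the zeroth-order source `𝒜` is gone; `μ` enters only through `W` and the one coefficient `μ_z(t,c)`).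

WHAT THIS IS NOT: not a claim about Navier–Stokes regularity and not the stub — calculus on the stratum (TH) (bears_on LADDER-NS N0,
item 20428 / crux 19708; the envelope/viscosity step and the Liouville endgame of (OSC) are NOT here).
-/

noncomputable section

-- the summit and its single sub-problem share the name (CONVENTIONS §1), as in every Theorems file
set_option linter.dupNamespace false

namespace Summit.NavierStokesRegularity.NavierStokesRegularity.Theorems.PoloidalWindowDoorLrcModEntireTwistingTHPlaneOscillation

open MeasureTheory Set Function Filter Topology Metric InnerProductSpace
open scoped RealInnerProductSpace InnerProductSpace Laplacian ContDiff
open Literature.Analysis Literature.Analysis.FluidPDE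
open Summit.NavierStokesRegularity.NavierStokesRegularity.Theorems.LocalSineTubeDoorProfileAlignedWindowRigidityAncient
open Summit.NavierStokesRegularity.NavierStokesRegularity.Theorems.PoloidalWindowDoorPoloidalWindowRigidityWindow
open Summit.NavierStokesRegularity.NavierStokesRegularity.Theorems.PoloidalWindowDoorPoloidalWindowRigidityFlat
open Summit.NavierStokesRegularity.NavierStokesRegularity.Theorems.PoloidalWindowDoorPoloidalWindowRigidityVelocityGradientLaw
open Summit.NavierStokesRegularity.NavierStokesRegularity.Theorems.PoloidalWindowDoorPoloidalWindowRigidityMaterialLeibniz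
open Summit.NavierStokesRegularity.NavierStokesRegularity.Theorems.PoloidalWindowDoorPoloidalWindowRigidityConstantShearMeans
open Summit.NavierStokesRegularity.NavierStokesRegularity.Theorems.PoloidalWindowDoorPoloidalWindowRigidityConstantShearSlice
open Summit.NavierStokesRegularity.NavierStokesRegularity.Theorems.PoloidalWindowDoorPoloidalWindowRigidityTimeHeightShearPressure
open Summit.NavierStokesRegularity.NavierStokesRegularity.Theorems.PoloidalWindowDoorPoloidalWindowRigiditySlopeFunctionPressure
open Summit.NavierStokesRegularity.NavierStokesRegularity.Theorems.PoloidalWindowDoorPoloidalWindowRigidityTimeHeightShearWeight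

/-! ### B2, generic part: calculus at an extremum of a function restricted to a horizontal plane -/
section PlaneCalculus

variable {G : EuclideanSpace ℝ (Fin 3) → ℝ} {x : EuclideanSpace ℝ (Fin 3)}

/-- A horizontal coordinate vector has no height component. -/
theorem single_apply_two_eq_zero {b : Fin 3} (hb : b ≠ 2) :
    (EuclideanSpace.single b (1 : ℝ) : EuclideanSpace ℝ (Fin 3)) 2 = 0 := by
  fin_cases b <;> simp_all

/-- The horizontal line `σ ↦ x + σ e_b` (`b ≠ 2`) through `x` stays in the plane `{y₂ = x₂}` and tends to `x` WITHIN that plane. -/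
theorem tendsto_line_nhdsWithin_plane {b : Fin 3} (hb : b ≠ 2) :
    Tendsto (fun σ : ℝ => x + σ • (EuclideanSpace.single b (1 : ℝ) : EuclideanSpace ℝ (Fin 3))) (𝓝 0)
      (𝓝[{y : EuclideanSpace ℝ (Fin 3) | y 2 = x 2}] x) := by
  refine tendsto_nhdsWithin_iff.2 ⟨?_, Eventually.of_forall fun σ => ?_⟩
  · have h : Continuous fun σ : ℝ => x + σ • (EuclideanSpace.single b (1 : ℝ) : EuclideanSpace ℝ (Fin 3)) := by
      fun_prop
    simpa using h.tendsto 0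
  · show (x + σ • (EuclideanSpace.single b (1 : ℝ) : EuclideanSpace ℝ (Fin 3))) 2 = x 2
    simp [Ne.symm hb]

/-- A local maximum of `G` on the plane `{y₂ = x₂}` at `x` is a local maximum of `σ ↦ G(x + σ e_b)` at `0` for every horizontal `b`. -/
theorem isLocalMax_line_of_planeMax (hmax : IsLocalMaxOn G {y : EuclideanSpace ℝ (Fin 3) | y 2 = x 2} x)
    {b : Fin 3} (hb : b ≠ 2) :
    IsLocalMax (fun σ : ℝ => G (x + σ • (EuclideanSpace.single b (1 : ℝ) : EuclideanSpace ℝ (Fin 3)))) 0 := by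
  have hx : (fun σ : ℝ => x + σ • (EuclideanSpace.single b (1 : ℝ) : EuclideanSpace ℝ (Fin 3))) 0 = x := by simp
  have hmax' : IsMaxFilter G (𝓝[{y : EuclideanSpace ℝ (Fin 3) | y 2 = x 2}] x)
      ((fun σ : ℝ => x + σ • (EuclideanSpace.single b (1 : ℝ) : EuclideanSpace ℝ (Fin 3))) 0) := by
    rw [hx]; exact hmax
  exact IsMaxFilter.comp_tendsto
    (g := fun σ : ℝ => x + σ • (EuclideanSpace.single b (1 : ℝ) : EuclideanSpace ℝ (Fin 3))) (b := (0 : ℝ))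
    hmax' (tendsto_line_nhdsWithin_plane hb)

/-- **At a plane-restricted local maximum the horizontal partial derivatives vanish.** -/
theorem fderiv_horiz_eq_zero_of_planeMax (hG : Differentiable ℝ G)
    (hmax : IsLocalMaxOn G {y : EuclideanSpace ℝ (Fin 3) | y 2 = x 2} x) {b : Fin 3} (hb : b ≠ 2) :
    fderiv ℝ G x (EuclideanSpace.single b 1) = 0 := by
  have hline := hasDerivAt_comp_line hG x (EuclideanSpace.single b (1 : ℝ)) 0
  rw [zero_smul, add_zero] at hline
  exact (isLocalMax_line_of_planeMax hmax hb).hasDerivAt_eq_zero hline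

/-- **At a plane-restricted local maximum of a `C²` function the pure horizontal second partials are non-positive.** -/
theorem fderiv_fderiv_horiz_nonpos_of_planeMax (hG : ContDiff ℝ 2 G)
    (hmax : IsLocalMaxOn G {y : EuclideanSpace ℝ (Fin 3) | y 2 = x 2} x) {b : Fin 3} (hb : b ≠ 2) :
    fderiv ℝ (fun y => fderiv ℝ G y (EuclideanSpace.single b 1)) x (EuclideanSpace.single b 1) ≤ 0 := by
  set e : EuclideanSpace ℝ (Fin 3) := EuclideanSpace.single b (1 : ℝ) with he
  set φ : ℝ → ℝ := fun σ => G (x + σ • e) with hφ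
  have hGd : Differentiable ℝ G := hG.differentiable (by norm_num)
  have hφ1 : deriv φ = fun σ => fderiv ℝ G (x + σ • e) e :=
    funext fun σ => (hasDerivAt_comp_line hGd x e σ).deriv
  have hD1 : ContDiff ℝ 1 fun z => fderiv ℝ G z e := (hG.fderiv_right (m := 1) le_rfl).clm_apply contDiff_const
  have hφ2 : deriv (deriv φ) 0 = fderiv ℝ (fun y => fderiv ℝ G y e) x e := by
    rw [hφ1]
    have h2 := hasDerivAt_comp_line (hD1.differentiable (by norm_num)) x e 0
    rw [zero_smul, add_zero] at h2
    exact h2.deriv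
  have hcφ : ContinuousAt φ 0 := (hGd.continuous.comp (by fun_prop)).continuousAt
  rw [← hφ2]
  exact IsLocalMax.deriv_deriv_nonpos (isLocalMax_line_of_planeMax hmax hb) hcφ

/-- Minimum version of `fderiv_horiz_eq_zero_of_planeMax`. -/
theorem fderiv_horiz_eq_zero_of_planeMin (hG : Differentiable ℝ G)
    (hmin : IsLocalMinOn G {y : EuclideanSpace ℝ (Fin 3) | y 2 = x 2} x) {b : Fin 3} (hb : b ≠ 2) :
    fderiv ℝ G x (EuclideanSpace.single b 1) = 0 := by
  have h := fderiv_horiz_eq_zero_of_planeMax (G := fun y => -G y) hG.neg hmin.neg hb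
  rw [fderiv_fun_neg] at h
  simpa using h

/-- Minimum version of `fderiv_fderiv_horiz_nonpos_of_planeMax`: the pure horizontal second partials are non-negative. -/
theorem fderiv_fderiv_horiz_nonneg_of_planeMin (hG : ContDiff ℝ 2 G)
    (hmin : IsLocalMinOn G {y : EuclideanSpace ℝ (Fin 3) | y 2 = x 2} x) {b : Fin 3} (hb : b ≠ 2) :
    0 ≤ fderiv ℝ (fun y => fderiv ℝ G y (EuclideanSpace.single b 1)) x (EuclideanSpace.single b 1) := by
  have h := fderiv_fderiv_horiz_nonpos_of_planeMax (G := fun y => -G y) hG.neg hmin.neg hb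
  have h1 : (fun y => fderiv ℝ (fun y => -G y) y (EuclideanSpace.single b 1)) =
      fun y => -fderiv ℝ G y (EuclideanSpace.single b 1) := by
    funext y; rw [fderiv_fun_neg]; rfl
  rw [h1, fderiv_fun_neg] at h
  have h2 : (-fderiv ℝ (fun y => fderiv ℝ G y (EuclideanSpace.single b 1)) x) (EuclideanSpace.single b 1) =
      -(fderiv ℝ (fun y => fderiv ℝ G y (EuclideanSpace.single b 1)) x (EuclideanSpace.single b 1)) := rfl
  rw [h2] at h
  linarith

/-- Any directional derivative splits over the coordinate frame: `DG(x)u = Σᵢ uᵢ ∂ᵢG(x)`. -/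
theorem fderiv_apply_eq_sum_coord (u : EuclideanSpace ℝ (Fin 3)) :
    fderiv ℝ G x u = ∑ i : Fin 3, u i * fderiv ℝ G x (EuclideanSpace.single i 1) := by
  conv_lhs => rw [← (EuclideanSpace.basisFun (Fin 3) ℝ).sum_repr u]
  simp [map_sum, map_smul]

/-- **At a plane-restricted local extremum every directional derivative is vertical**: `DG(x)u = u₂ ∂₂G(x)`. -/
theorem fderiv_apply_of_horiz_eq_zero
    (h0 : fderiv ℝ G x (EuclideanSpace.single 0 1) = 0) (h1 : fderiv ℝ G x (EuclideanSpace.single 1 1) = 0)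
    (u : EuclideanSpace ℝ (Fin 3)) :
    fderiv ℝ G x u = u 2 * fderiv ℝ G x (EuclideanSpace.single 2 1) := by
  rw [fderiv_apply_eq_sum_coord, Fin.sum_univ_three, h0, h1]
  ring

/-- **At a plane-restricted local maximum of a `C²` function, `ΔG ≤ ∂₂∂₂G`** (`Δ = ∂₀² + ∂₁² + ∂₂²` and the two horizontal
terms are `≤ 0`). -/
theorem laplacian_le_vert_of_planeMax (hG : ContDiff ℝ 2 G)
    (hmax : IsLocalMaxOn G {y : EuclideanSpace ℝ (Fin 3) | y 2 = x 2} x) :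
    Δ G x ≤ fderiv ℝ (fun y => fderiv ℝ G y (EuclideanSpace.single 2 1)) x (EuclideanSpace.single 2 1) := by
  rw [Tsai2021.laplacian_eq_sum_three hG x, Fin.sum_univ_three]
  have h0 := fderiv_fderiv_horiz_nonpos_of_planeMax hG hmax (b := 0) (by decide)
  have h1 := fderiv_fderiv_horiz_nonpos_of_planeMax hG hmax (b := 1) (by decide)
  linarith

/-- **At a plane-restricted local minimum of a `C²` function, `∂₂∂₂G ≤ ΔG`.** -/
theorem vert_le_laplacian_of_planeMin (hG : ContDiff ℝ 2 G)
    (hmin : IsLocalMinOn G {y : EuclideanSpace ℝ (Fin 3) | y 2 = x 2} x) :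
    fderiv ℝ (fun y => fderiv ℝ G y (EuclideanSpace.single 2 1)) x (EuclideanSpace.single 2 1) ≤ Δ G x := by
  rw [Tsai2021.laplacian_eq_sum_three hG x, Fin.sum_univ_three]
  have h0 := fderiv_fderiv_horiz_nonneg_of_planeMin hG hmin (b := 0) (by decide)
  have h1 := fderiv_fderiv_horiz_nonneg_of_planeMin hG hmin (b := 1) (by decide)
  linarith

end PlaneCalculus

/-! ### The class setting: `W(t,·) = (1 − μ(t,·₂))·v₂(t,·)` -/
section Class

variable {C : ℝ} {v : ℝ → EuclideanSpace ℝ (Fin 3) → EuclideanSpace ℝ (Fin 3)}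
variable (hrate : HasTypeITimeDecay C v) (hcont : ContinuousOn (uncurry v) (Iio (0 : ℝ) ×ˢ univ))
  (hmild : ∀ s t : ℝ, s < t → t < 0 → ∀ x,
    v t x = UnboundedOperators.heatExtension (v s) (t - s) x - oseenDuhamel 1 s v v t x)
  (hdiv : ∀ t < 0, VectorCalculus.IsDivFree (v t))

include hrate hcont hmild hdiv

/-- `W(t,·) = (1 − μ(t,·₂))·v₂(t,·)` is `C²` on a slice of a class profile when `μ(t,·)` is `C²`. -/
theorem contDiff_W_slice {μ : ℝ → ℝ → ℝ} {t : ℝ} (hμt : ContDiff ℝ 2 (μ t)) (ht : t < 0) :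
    ContDiff ℝ 2 (fun y : EuclideanSpace ℝ (Fin 3) => (1 - μ t (y 2)) * v t y 2) :=
  (contDiff_const.sub (contDiff_comp_height hμt)).mul ((contDiff_vert_slice hrate hcont hmild hdiv ht).of_le (by norm_cast))

/-- **B2 — PLANE-EXTREMUM CONDITIONS for `W(t,·)`.**  At a local maximum `x` of `W(t,·) = (1 − μ(t,·₂))v₂(t,·)` restricted to the
horizontal plane `{y₂ = x₂}` (`t < 0`, `μ(t,·)` of class `C²`): `∂₀W = ∂₁W = 0`, `∂₀∂₀W + ∂₁∂₁W ≤ 0`, the convective derivative is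
vertical, `DW(x)(v(t,x)) = v₂(t,x)·∂₂W(x)`, and `ΔW(x) ≤ ∂₂∂₂W(x)`. -/
theorem planeExtremum_conditions {μ : ℝ → ℝ → ℝ} {t : ℝ} (hμt : ContDiff ℝ 2 (μ t)) (ht : t < 0)
    {x : EuclideanSpace ℝ (Fin 3)}
    (hmax : IsLocalMaxOn (fun y : EuclideanSpace ℝ (Fin 3) => (1 - μ t (y 2)) * v t y 2)
      {y : EuclideanSpace ℝ (Fin 3) | y 2 = x 2} x) :
    fderiv ℝ (fun y : EuclideanSpace ℝ (Fin 3) => (1 - μ t (y 2)) * v t y 2) x (EuclideanSpace.single 0 1) = 0 ∧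
    fderiv ℝ (fun y : EuclideanSpace ℝ (Fin 3) => (1 - μ t (y 2)) * v t y 2) x (EuclideanSpace.single 1 1) = 0 ∧
    fderiv ℝ (fun y => fderiv ℝ (fun y : EuclideanSpace ℝ (Fin 3) => (1 - μ t (y 2)) * v t y 2) y (EuclideanSpace.single 0 1)) x
          (EuclideanSpace.single 0 1) +
        fderiv ℝ (fun y => fderiv ℝ (fun y : EuclideanSpace ℝ (Fin 3) => (1 - μ t (y 2)) * v t y 2) y (EuclideanSpace.single 1 1)) x
          (EuclideanSpace.single 1 1) ≤ 0 ∧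
    fderiv ℝ (fun y : EuclideanSpace ℝ (Fin 3) => (1 - μ t (y 2)) * v t y 2) x (v t x) =
      v t x 2 * fderiv ℝ (fun y : EuclideanSpace ℝ (Fin 3) => (1 - μ t (y 2)) * v t y 2) x (EuclideanSpace.single 2 1) ∧
    Δ (fun y : EuclideanSpace ℝ (Fin 3) => (1 - μ t (y 2)) * v t y 2) x ≤
      fderiv ℝ (fun y => fderiv ℝ (fun y : EuclideanSpace ℝ (Fin 3) => (1 - μ t (y 2)) * v t y 2) y (EuclideanSpace.single 2 1)) x
        (EuclideanSpace.single 2 1) := by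
  have hW := contDiff_W_slice hrate hcont hmild hdiv hμt ht
  have hWd : Differentiable ℝ (fun y : EuclideanSpace ℝ (Fin 3) => (1 - μ t (y 2)) * v t y 2) := hW.differentiable (by norm_num)
  have h0 := fderiv_horiz_eq_zero_of_planeMax hWd hmax (b := 0) (by decide)
  have h1 := fderiv_horiz_eq_zero_of_planeMax hWd hmax (b := 1) (by decide)
  refine ⟨h0, h1, ?_, fderiv_apply_of_horiz_eq_zero h0 h1 _, laplacian_le_vert_of_planeMax hW hmax⟩
  have h00 := fderiv_fderiv_horiz_nonpos_of_planeMax hW hmax (b := 0) (by decide)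
  have h11 := fderiv_fderiv_horiz_nonpos_of_planeMax hW hmax (b := 1) (by decide)
  linarith

/-- Minimum version of `planeExtremum_conditions`. -/
theorem planeExtremum_conditions_min {μ : ℝ → ℝ → ℝ} {t : ℝ} (hμt : ContDiff ℝ 2 (μ t)) (ht : t < 0)
    {x : EuclideanSpace ℝ (Fin 3)}
    (hmin : IsLocalMinOn (fun y : EuclideanSpace ℝ (Fin 3) => (1 - μ t (y 2)) * v t y 2)
      {y : EuclideanSpace ℝ (Fin 3) | y 2 = x 2} x) :
    fderiv ℝ (fun y : EuclideanSpace ℝ (Fin 3) => (1 - μ t (y 2)) * v t y 2) x (EuclideanSpace.single 0 1) = 0 ∧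
    fderiv ℝ (fun y : EuclideanSpace ℝ (Fin 3) => (1 - μ t (y 2)) * v t y 2) x (EuclideanSpace.single 1 1) = 0 ∧
    0 ≤ fderiv ℝ (fun y => fderiv ℝ (fun y : EuclideanSpace ℝ (Fin 3) => (1 - μ t (y 2)) * v t y 2) y (EuclideanSpace.single 0 1)) x
          (EuclideanSpace.single 0 1) +
        fderiv ℝ (fun y => fderiv ℝ (fun y : EuclideanSpace ℝ (Fin 3) => (1 - μ t (y 2)) * v t y 2) y (EuclideanSpace.single 1 1)) x
          (EuclideanSpace.single 1 1) ∧
    fderiv ℝ (fun y : EuclideanSpace ℝ (Fin 3) => (1 - μ t (y 2)) * v t y 2) x (v t x) =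
      v t x 2 * fderiv ℝ (fun y : EuclideanSpace ℝ (Fin 3) => (1 - μ t (y 2)) * v t y 2) x (EuclideanSpace.single 2 1) ∧
    fderiv ℝ (fun y => fderiv ℝ (fun y : EuclideanSpace ℝ (Fin 3) => (1 - μ t (y 2)) * v t y 2) y (EuclideanSpace.single 2 1)) x
        (EuclideanSpace.single 2 1) ≤
      Δ (fun y : EuclideanSpace ℝ (Fin 3) => (1 - μ t (y 2)) * v t y 2) x := by
  have hW := contDiff_W_slice hrate hcont hmild hdiv hμt ht
  have hWd : Differentiable ℝ (fun y : EuclideanSpace ℝ (Fin 3) => (1 - μ t (y 2)) * v t y 2) := hW.differentiable (by norm_num)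
  have h0 := fderiv_horiz_eq_zero_of_planeMin hWd hmin (b := 0) (by decide)
  have h1 := fderiv_horiz_eq_zero_of_planeMin hWd hmin (b := 1) (by decide)
  refine ⟨h0, h1, ?_, fderiv_apply_of_horiz_eq_zero h0 h1 _, vert_le_laplacian_of_planeMin hW hmin⟩
  have h00 := fderiv_fderiv_horiz_nonneg_of_planeMin hW hmin (b := 0) (by decide)
  have h11 := fderiv_fderiv_horiz_nonneg_of_planeMin hW hmin (b := 1) (by decide)
  linarith

/-! ### B1: the height-only source cancels between two points of the same plane -/
variable (hpol : ∀ s < 0, ∀ y, ⟪curl (v s) y, EuclideanSpace.single 2 1⟫_ℝ = 0)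
  {μ : ℝ → ℝ → ℝ} (hμ : ContDiff ℝ 3 (uncurry μ))

include hpol hμ

/-- **The doubled source `2𝒜 := 2(1−μ)f₂ − 2(μ_t − μ_zz)v₂ − μ_z v₂² + 4μ_z∂₂v₂` is constant on horizontal planes** near which (TH)
holds (slope `μ(s,y₂)` in a space–time neighbourhood of every point `(t,y)` of the plane `{y₂ = x₂}`): `2𝒜(t,x) = 2𝒜(t,x′)` for `x′₂ = x₂`
(segment argument of `…residual_TH_eq_of_height_eq` on `∇ₕ(2𝒜) = 0` = `…horizFDeriv_weightSource_eq_zero`; division-free, no `μ < 1`). -/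
theorem weightSource_eq_of_height_eq {t : ℝ} (ht : t < 0) {x x' : EuclideanSpace ℝ (Fin 3)} (hxx' : x 2 = x' 2)
    (hslope : ∀ y : EuclideanSpace ℝ (Fin 3), y 2 = x 2 →
      ∀ᶠ z in 𝓝 ((t, y) : ℝ × EuclideanSpace ℝ (Fin 3)), ∀ b : Fin 3, b ≠ 2 →
        fderiv ℝ (v z.1) z.2 (EuclideanSpace.single 2 1) b =
          μ z.1 (z.2 2) * fderiv ℝ (v z.1) z.2 (EuclideanSpace.single b 1) 2) :
    2 * (1 - μ t (x 2)) * (timeDerivWithin (Iio 0) v t x + convect (v t) (v t) x - Δ (v t) x) 2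
        - 2 * (deriv (fun s => μ s (x 2)) t - deriv (deriv (μ t)) (x 2)) * v t x 2
        - deriv (μ t) (x 2) * v t x 2 ^ 2
        + 4 * deriv (μ t) (x 2) * fderiv ℝ (v t) x (EuclideanSpace.single 2 1) 2 =
      2 * (1 - μ t (x' 2)) * (timeDerivWithin (Iio 0) v t x' + convect (v t) (v t) x' - Δ (v t) x') 2
        - 2 * (deriv (fun s => μ s (x' 2)) t - deriv (deriv (μ t)) (x' 2)) * v t x' 2
        - deriv (μ t) (x' 2) * v t x' 2 ^ 2
        + 4 * deriv (μ t) (x' 2) * fderiv ℝ (v t) x' (EuclideanSpace.single 2 1) 2 := by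
  have hA : IsTypeIAncientMild C v := isTypeIAncientMild_of_class hrate hcont hmild hdiv
  have hs : ContDiff ℝ ∞ (v t) := hA.contDiff_slice ht
  have hμ2 : ContDiff ℝ 2 (uncurry μ) := hμ.of_le (by norm_cast)
  have hμt3 : ContDiff ℝ 3 (μ t) := hμ.comp (contDiff_const.prodMk contDiff_id)
  have hμt2 : ContDiff ℝ 2 (μ t) := hμt3.of_le (by norm_cast)
  have hμ'2 : ContDiff ℝ 2 (deriv (μ t)) :=
    (contDiff_succ_iff_deriv.1 (hμt3 : ContDiff ℝ ((2 : ℕ∞) + 1 : ℕ∞) (μ t))).2.2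
  have hμ''1 : ContDiff ℝ 1 (deriv (deriv (μ t))) :=
    (contDiff_succ_iff_deriv.1 (hμ'2 : ContDiff ℝ ((1 : ℕ∞) + 1 : ℕ∞) (deriv (μ t)))).2.2
  -- the time partial `μ_t(t,·)` as a differentiable function of the height
  obtain ⟨Mt, hMt⟩ : ∃ Mt : ℝ → ℝ, ∀ z, Mt z = deriv (fun s => μ s z) t := ⟨_, fun _ => rfl⟩
  have hMt_eq : Mt = fun z => fderiv ℝ (uncurry μ) (t, z) (1, 0) := funext fun z => by
    rw [hMt]; exact (hasDerivAt_timeSlice_of_uncurry ((hμ2.differentiable (by norm_num)) (t, z))).deriv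
  have hMtd : Differentiable ℝ Mt := by
    rw [hMt_eq]
    exact (((hμ.fderiv_right (m := 2) (by norm_cast)).clm_apply contDiff_const).comp
      (contDiff_const.prodMk contDiff_id)).differentiable (by norm_num)
  set S : EuclideanSpace ℝ (Fin 3) → ℝ := fun y =>
    2 * (1 - μ t (y 2)) * (timeDerivWithin (Iio 0) v t y + convect (v t) (v t) y - Δ (v t) y) 2
      - 2 * (deriv (fun s => μ s (y 2)) t - deriv (deriv (μ t)) (y 2)) * v t y 2
      - deriv (μ t) (y 2) * v t y 2 ^ 2
      + 4 * deriv (μ t) (y 2) * fderiv ℝ (v t) y (EuclideanSpace.single 2 1) 2 with hS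
  have hR : ∀ y, DifferentiableAt ℝ
      (fun y => timeDerivWithin (Iio 0) v t y + convect (v t) (v t) y - Δ (v t) y) y := by
    have h1 : ContDiff ℝ ∞ (timeDerivWithin (Iio 0) v t) := by
      rw [timeDerivWithin_Iio_eq_deriv ht]; exact contDiff_timeDeriv_slice hrate hcont hmild hdiv ht
    have h2 : ContDiff ℝ ∞ (fun y => convect (v t) (v t) y) :=
      (hs.fderiv_right (m := ∞) (by norm_cast)).clm_apply hs
    have h3 : ContDiff ℝ 1 (Δ (v t)) := contDiff_laplacian (n := 1) (hs.of_le (by norm_cast))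
    exact fun y => (((h1.differentiable (by simp)) y).add ((h2.differentiable (by simp)) y)).sub
      ((h3.differentiable (by simp)) y)
  have hF2d : Differentiable ℝ
      (fun y => (timeDerivWithin (Iio 0) v t y + convect (v t) (v t) y - Δ (v t) y) 2) := fun y =>
    ((EuclideanSpace.proj (𝕜 := ℝ) (2 : Fin 3) : EuclideanSpace ℝ (Fin 3) →L[ℝ] ℝ).differentiableAt).comp y (hR y)
  have hθd : Differentiable ℝ (fun y => v t y 2) :=
    (contDiff_vert_slice hrate hcont hmild hdiv ht).differentiable (by simp)
  have hEd : Differentiable ℝ (fun y => fderiv ℝ (v t) y (EuclideanSpace.single 2 1) 2) :=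
    (contDiff_fderiv_coord hrate hcont hmild hdiv ht (EuclideanSpace.single 2 1) 2).differentiable (by simp)
  have hSd : Differentiable ℝ S := by
    have e : S = fun y =>
        2 * (1 - μ t (y 2)) * (timeDerivWithin (Iio 0) v t y + convect (v t) (v t) y - Δ (v t) y) 2
          - 2 * (Mt (y 2) - deriv (deriv (μ t)) (y 2)) * v t y 2
          - deriv (μ t) (y 2) * v t y 2 ^ 2
          + 4 * deriv (μ t) (y 2) * fderiv ℝ (v t) y (EuclideanSpace.single 2 1) 2 := by
      funext y; rw [hS, hMt]
    rw [e]
    have h1 : Differentiable ℝ (fun y : EuclideanSpace ℝ (Fin 3) => 2 * (1 - μ t (y 2))) :=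
      (((contDiff_comp_height hμt2).differentiable (by norm_num)).const_sub 1).const_mul 2
    have hMth : Differentiable ℝ (fun y : EuclideanSpace ℝ (Fin 3) => Mt (y 2)) :=
      hMtd.comp (EuclideanSpace.proj (𝕜 := ℝ) (2 : Fin 3) : EuclideanSpace ℝ (Fin 3) →L[ℝ] ℝ).differentiable
    have h2 : Differentiable ℝ (fun y : EuclideanSpace ℝ (Fin 3) => 2 * (Mt (y 2) - deriv (deriv (μ t)) (y 2))) :=
      (hMth.sub ((contDiff_comp_height hμ''1).differentiable (by norm_num))).const_mul 2
    have h3 : Differentiable ℝ (fun y : EuclideanSpace ℝ (Fin 3) => deriv (μ t) (y 2)) :=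
      (contDiff_comp_height hμ'2).differentiable (by norm_num)
    exact (((h1.mul hF2d).sub (h2.mul hθd)).sub (h3.mul (hθd.pow 2))).add ((h3.const_mul 4).mul hEd)
  -- `∇ₕ S = 0` at every point of the plane (the pressure law, via `horizFDeriv_weightSource_eq_zero`)
  have hSb : ∀ y : EuclideanSpace ℝ (Fin 3), y 2 = x 2 → ∀ b : Fin 3, b ≠ 2 →
      fderiv ℝ S y (EuclideanSpace.single b 1) = 0 := by
    intro y hy b hb
    have h := horizFDeriv_weightSource_eq_zero hrate hcont hmild hdiv hpol hμ ht y (hslope y hy) hb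
    rw [hS]; exact h
  -- integrate along the horizontal segment from `x` to `x'`
  set d : EuclideanSpace ℝ (Fin 3) := x' - x with hd
  have hd2 : d 2 = 0 := by rw [hd]; simp [hxx']
  set γ : ℝ → ℝ := fun s => S (x + s • d) with hγ
  have hγd : ∀ s, HasDerivAt γ 0 s := by
    intro s
    have hline : HasDerivAt (fun s : ℝ => x + s • d) d s := by
      simpa using ((hasDerivAt_id s).smul_const d).const_add x
    have h := (hSd (x + s • d)).hasFDerivAt.comp_hasDerivAt s hline
    have hplane : (x + s • d) 2 = x 2 := by simp [hd2]
    have hzero : fderiv ℝ S (x + s • d) d = 0 := by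
      rw [fderiv_apply_eq_sum_coord]
      simp only [Fin.sum_univ_three, hSb _ hplane 0 (by decide), hSb _ hplane 1 (by decide), hd2, mul_zero,
        zero_mul, add_zero]
    rw [hzero] at h
    exact h
  have hconst := is_const_of_deriv_eq_zero (fun s => (hγd s).differentiableAt) (fun s => (hγd s).deriv) 0 1
  simp only [hγ, zero_smul, add_zero, one_smul] at hconst
  have hx' : x + d = x' := by rw [hd]; abel
  rw [hx'] at hconst
  simpa only [hS] using hconst

/-- **B1 — THE TWO-POINT MATERIAL IDENTITY AT EQUAL HEIGHT.**  With `W(s,y) := (1 − μ(s,y₂))·v₂(s,y)` and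
`𝓛W := ∂ₜW + DW·v − ΔW`, for two points `x, x′` of the same horizontal plane near which (TH) holds (slope `μ`, jointly `C³`):
`𝓛W(t,x) − 𝓛W(t,x′) = −(μ_z(t,x₂)/2)·(v₂(t,x)² − v₂(t,x′)²)` — the height-only source `𝒜(t,x₂)` of `material_W_eq` cancels. -/
theorem material_W_sub_of_height_eq {t : ℝ} (ht : t < 0) {x x' : EuclideanSpace ℝ (Fin 3)} (hxx' : x 2 = x' 2)
    (hslope : ∀ y : EuclideanSpace ℝ (Fin 3), y 2 = x 2 →
      ∀ᶠ z in 𝓝 ((t, y) : ℝ × EuclideanSpace ℝ (Fin 3)), ∀ b : Fin 3, b ≠ 2 →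
        fderiv ℝ (v z.1) z.2 (EuclideanSpace.single 2 1) b =
          μ z.1 (z.2 2) * fderiv ℝ (v z.1) z.2 (EuclideanSpace.single b 1) 2) :
    (deriv (fun s => (1 - μ s (x 2)) * v s x 2) t
        + fderiv ℝ (fun y : EuclideanSpace ℝ (Fin 3) => (1 - μ t (y 2)) * v t y 2) x (v t x)
        - Δ (fun y : EuclideanSpace ℝ (Fin 3) => (1 - μ t (y 2)) * v t y 2) x)
      - (deriv (fun s => (1 - μ s (x' 2)) * v s x' 2) t
        + fderiv ℝ (fun y : EuclideanSpace ℝ (Fin 3) => (1 - μ t (y 2)) * v t y 2) x' (v t x')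
        - Δ (fun y : EuclideanSpace ℝ (Fin 3) => (1 - μ t (y 2)) * v t y 2) x') =
      -(deriv (μ t) (x 2) / 2) * (v t x 2 ^ 2 - v t x' 2 ^ 2) := by
  have hμ2 : ContDiff ℝ 2 (uncurry μ) := hμ.of_le (by norm_cast)
  have h1 := material_W_eq hrate hcont hmild hdiv hμ2 ht x
  have h2 := material_W_eq hrate hcont hmild hdiv hμ2 ht x'
  have hS := weightSource_eq_of_height_eq hrate hcont hmild hdiv hpol hμ ht hxx' hslope
  rw [h1, h2]
  rw [← hxx'] at hS ⊢
  linear_combination (1 / 2 : ℝ) * hS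

/-- **B1 + B2 — THE TWO-POINT INEQUALITY OF (OSC).**  If `x⁺` is a local maximum and `x⁻` a local minimum of `W(t,·)` restricted to
the SAME horizontal plane (near which (TH) holds), then with `∂₂W := DW(·)e₂`, `∂₂∂₂W := D(∂₂W)(·)e₂`:
`[∂ₜW + v₂∂₂W − ∂₂∂₂W](t,x⁺) − [∂ₜW + v₂∂₂W − ∂₂∂₂W](t,x⁻) ≤ −(μ_z(t,x⁺₂)/2)·(v₂(t,x⁺)² − v₂(t,x⁻)²)`
(`ΔW ≤ ∂₂∂₂W` at `x⁺`, `≥` at `x⁻`, `DW·v = v₂∂₂W` at both, and B1). -/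
theorem osc_twoPoint {t : ℝ} (ht : t < 0) {xp xm : EuclideanSpace ℝ (Fin 3)} (hx : xp 2 = xm 2)
    (hslope : ∀ y : EuclideanSpace ℝ (Fin 3), y 2 = xp 2 →
      ∀ᶠ z in 𝓝 ((t, y) : ℝ × EuclideanSpace ℝ (Fin 3)), ∀ b : Fin 3, b ≠ 2 →
        fderiv ℝ (v z.1) z.2 (EuclideanSpace.single 2 1) b =
          μ z.1 (z.2 2) * fderiv ℝ (v z.1) z.2 (EuclideanSpace.single b 1) 2)
    (hmax : IsLocalMaxOn (fun y : EuclideanSpace ℝ (Fin 3) => (1 - μ t (y 2)) * v t y 2)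
      {y : EuclideanSpace ℝ (Fin 3) | y 2 = xp 2} xp)
    (hmin : IsLocalMinOn (fun y : EuclideanSpace ℝ (Fin 3) => (1 - μ t (y 2)) * v t y 2)
      {y : EuclideanSpace ℝ (Fin 3) | y 2 = xm 2} xm) :
    (deriv (fun s => (1 - μ s (xp 2)) * v s xp 2) t
        + v t xp 2 * fderiv ℝ (fun y : EuclideanSpace ℝ (Fin 3) => (1 - μ t (y 2)) * v t y 2) xp (EuclideanSpace.single 2 1)
        - fderiv ℝ (fun y => fderiv ℝ (fun y : EuclideanSpace ℝ (Fin 3) => (1 - μ t (y 2)) * v t y 2) y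
            (EuclideanSpace.single 2 1)) xp (EuclideanSpace.single 2 1))
      - (deriv (fun s => (1 - μ s (xm 2)) * v s xm 2) t
        + v t xm 2 * fderiv ℝ (fun y : EuclideanSpace ℝ (Fin 3) => (1 - μ t (y 2)) * v t y 2) xm (EuclideanSpace.single 2 1)
        - fderiv ℝ (fun y => fderiv ℝ (fun y : EuclideanSpace ℝ (Fin 3) => (1 - μ t (y 2)) * v t y 2) y
            (EuclideanSpace.single 2 1)) xm (EuclideanSpace.single 2 1)) ≤
      -(deriv (μ t) (xp 2) / 2) * (v t xp 2 ^ 2 - v t xm 2 ^ 2) := by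
  have hμt3 : ContDiff ℝ 3 (μ t) := hμ.comp (contDiff_const.prodMk contDiff_id)
  have hμt2 : ContDiff ℝ 2 (μ t) := hμt3.of_le (by norm_cast)
  obtain ⟨-, -, -, hvp, hLp⟩ := planeExtremum_conditions hrate hcont hmild hdiv hμt2 ht hmax
  obtain ⟨-, -, -, hvm, hLm⟩ := planeExtremum_conditions_min hrate hcont hmild hdiv hμt2 ht hmin
  have hB1 := material_W_sub_of_height_eq hrate hcont hmild hdiv hpol hμ ht hx hslope
  rw [hvp, hvm] at hB1
  linarith

end Class

end Summit.NavierStokesRegularity.NavierStokesRegularity.Theorems.PoloidalWindowDoorLrcModEntireTwistingTHPlaneOscillation
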